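import Summits.QuantumAdvantage.AdviceFreeQNC0.ShiftedProducts
import HarnessLib

/-!
# Cell qa-qnc0 (rung F-Q1, route RingFrame, crux α, line `product`): proportional residue
# avoidance (PLDAMS) is monotone in the dimension

Planner statement HOME/qa-qnc0-p1/TARGET.md §17.8(e) ("PLDAMS IS MONOTONE IN THE DIMENSION — exact
size-biased subcube averaging"), now a kernel theorem.  For a degree bound `d` and a dimension `m`
say that `(m, d)` is `κ`-BALANCED if every `g : {0,1}^m → 𝔽₂` of degree `≤ d` has at least a
`κ`-fraction of its support in each residue class of the Hamming weight mod `3`: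
`κ · #{g ≠ 0} ≤ #{g ≠ 0, |v| ≡ r (3)}` for every `r` (the zero polynomial satisfies this trivially).

* `residueBalance_real_mono` (`PLDAMSMonotone`): `κ`-balance of `(m, d)` implies `κ`-balance of
  `(n, d)` for every `n ≥ m` — fix the last coordinate to `β ∈ {0,1}`: both restrictions
  `v ↦ g(v, β)` have degree `≤ d` (`Smolensky.comp_subst_mem_lowDeg`), their supports partition
  the support of `g`, and the class `r` of `(v, β)` is the class `r − β` of `v`; induct.
* `pldams_of_critical_dimension`: hence the planner's ladder statements `PLDAMSAt(d(n))` are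
  decided at the single critical dimension `n₀(d)`: a bound proved (or certified) there holds for
  all larger `n` with the same constant, and restriction arguments can only move to the harder,
  smaller dimension (TARGET §17.8(e) (1)–(2)).

The cell's statement (qa-qnc0 TARGET.md §17.8(e)), not in print.  WHAT THIS IS NOT: no bound on
the balance constant itself beyond the landed rungs (`pldamsLogRung`, `weakPLDAMSq`,
`sparse_card_support_le_four_mul_card_class`); nothing on `LDMAPolylog` or on α; no separation.
-/

noncomputable section

namespace Summit.QuantumAdvantage.AdviceFreeQNC0

open Finset
open Literature.Computability.MetaComplexity Literature.Computability.MetaComplexity.Smolensky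
open Literature.Computability.MetaComplexity.Hegedus

/-! ### Fixing the last coordinate -/

/-- Restricting the last coordinate to a constant keeps the degree. [cite: JuknaBFC2012, §2.1] -/
theorem comp_snoc_mem_lowDeg {n d : ℕ} {g : CubeFn (ZMod 2) (n + 1)}
    (hg : g ∈ lowDeg (ZMod 2) (n + 1) d) (β : Bool) :
    (fun v : Fin n → Bool => g (Fin.snoc v β)) ∈ lowDeg (ZMod 2) n d := by
  refine comp_subst_mem_lowDeg (fun (v : Fin n → Bool) => (Fin.snoc v β : Fin (n + 1) → Bool))
    (fun i => ?_) hg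
  refine Fin.lastCases ?_ (fun j => ?_) i
  · exact Or.inl ⟨β, fun v => by simp⟩
  · exact Or.inr ⟨j, fun v => by simp⟩

/-- `|(v, β)| = |v| + [β]`. [folklore] -/
theorem wt_snoc {n : ℕ} (v : Fin n → Bool) (β : Bool) :
    wt (Fin.snoc v β : Fin (n + 1) → Bool) = wt v + (if β then 1 else 0) := by
  unfold wt
  rw [Finset.card_filter, Finset.card_filter, Fin.sum_univ_castSucc]
  simp only [Fin.snoc_castSucc, Fin.snoc_last]

/-- Counting points of the `(n+1)`-cube through the last coordinate: for any predicate `P`,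
`#{u : P u} = Σ_β #{v : P (v, β)}`. [folklore] -/
theorem card_filter_succ_eq_sum {n : ℕ} (P : (Fin (n + 1) → Bool) → Prop) [DecidablePred P] :
    (univ.filter P).card =
      ∑ β : Bool, (univ.filter fun v : Fin n → Bool => P (Fin.snoc v β)).card := by
  classical
  -- fibre the image of `{u : P u}` under `u ↦ (init u, u last)` over the last coordinate
  set S := (univ.filter P).map
    ⟨fun u => (Fin.init u, u (Fin.last n)), fun u u' h => by
      have h' : (Fin.init u, u (Fin.last n)) = (Fin.init u', u' (Fin.last n)) := h
      have h1 : Fin.init u = Fin.init u' := (Prod.ext_iff.1 h').1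
      have h2 : u (Fin.last n) = u' (Fin.last n) := (Prod.ext_iff.1 h').2
      rw [← Fin.snoc_init_self u, ← Fin.snoc_init_self u', h1, h2]⟩ with hS
  have hcard : (univ.filter P).card = S.card := by rw [hS, Finset.card_map]
  rw [hcard, card_eq_sum_card_fibre_snd S]
  refine Finset.sum_congr rfl fun β _ => ?_
  refine card_fibre_snd_eq S β _ fun v => ?_
  rw [hS, Finset.mem_map, Finset.mem_filter]
  constructor
  · rintro ⟨u, hu, huv⟩
    rw [Finset.mem_filter] at hu
    have e : Fin.snoc v β = u := by
      have h1 : Fin.init u = v := (Prod.ext_iff.1 huv).1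
      have h2 : u (Fin.last n) = β := (Prod.ext_iff.1 huv).2
      rw [← h1, ← h2, Fin.snoc_init_self]
    exact ⟨Finset.mem_univ v, e ▸ hu.2⟩
  · rintro ⟨-, hv⟩
    refine ⟨Fin.snoc v β, Finset.mem_filter.2 ⟨Finset.mem_univ _, hv⟩, ?_⟩
    change (Fin.init (Fin.snoc v β : Fin (n + 1) → Bool),
      (Fin.snoc v β : Fin (n + 1) → Bool) (Fin.last n)) = (v, β)
    rw [Fin.init_snoc, Fin.snoc_last]

/-! ### Monotonicity -/

/-- **`PLDAMSMonotone` (planner TARGET §17.8(e)): residue balance is monotone in the dimension.**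
If every degree-`≤ d` polynomial `g` on `{0,1}^m` has `κ · #{g ≠ 0} ≤ #{g ≠ 0, |v| ≡ r (3)}` for
every `r` (the planner's PLDAMS shape, real constant `κ`), then so does every degree-`≤ d`
polynomial on `{0,1}ⁿ` for every `n ≥ m`: fix the last coordinate, the two restrictions have
degree `≤ d`, their supports partition the support and the class of `(v, β)` is the class
`r − β` of `v`.  So the planner's `κ₀*(n, d)` is non-decreasing in `n`, and restriction arguments
can only move to the harder, smaller dimension. (Cell statement, TARGET.md §17.8(e).) -/
theorem residueBalance_real_mono {m d : ℕ} {κ : ℝ}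
    (h : ∀ g : CubeFn (ZMod 2) m, g ∈ lowDeg (ZMod 2) m d → ∀ r : ℕ,
      κ * ((univ.filter fun v : Fin m → Bool => g v ≠ 0).card : ℝ) ≤
        ((univ.filter fun v : Fin m → Bool => g v ≠ 0 ∧ wt v % 3 = r % 3).card : ℝ)) :
    ∀ n : ℕ, m ≤ n → ∀ g : CubeFn (ZMod 2) n, g ∈ lowDeg (ZMod 2) n d → ∀ r : ℕ,
      κ * ((univ.filter fun u : Fin n → Bool => g u ≠ 0).card : ℝ) ≤
        ((univ.filter fun u : Fin n → Bool => g u ≠ 0 ∧ wt u % 3 = r % 3).card : ℝ) := by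
  intro n hmn
  induction n, hmn using Nat.le_induction with
  | base => exact h
  | succ n _ ih =>
    intro g hg r
    classical
    rw [card_filter_succ_eq_sum (fun u : Fin (n + 1) → Bool => g u ≠ 0),
      card_filter_succ_eq_sum (fun u : Fin (n + 1) → Bool => g u ≠ 0 ∧ wt u % 3 = r % 3)]
    push_cast
    rw [Finset.mul_sum]
    refine Finset.sum_le_sum fun β _ => ?_
    set r' := r + 2 * (if β then 1 else 0) with hr'
    have hcl : (univ.filter fun v : Fin n → Bool =>
        g (Fin.snoc v β) ≠ 0 ∧ wt (Fin.snoc v β : Fin (n + 1) → Bool) % 3 = r % 3) =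
        univ.filter fun v : Fin n → Bool => g (Fin.snoc v β) ≠ 0 ∧ wt v % 3 = r' % 3 := by
      refine Finset.filter_congr fun v _ => ?_
      rw [wt_snoc, hr']
      constructor
      · rintro ⟨h1, h2⟩; exact ⟨h1, by cases β <;> simp at h2 ⊢ <;> omega⟩
      · rintro ⟨h1, h2⟩; exact ⟨h1, by cases β <;> simp at h2 ⊢ <;> omega⟩
    rw [hcl]
    exact ih (fun v => g (Fin.snoc v β)) (comp_snoc_mem_lowDeg hg β) r'

/-- **Corollary: PLDAMS is a single-dimension statement.**  If for some function `n₀` of the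
degree every degree-`≤ d` polynomial on `{0,1}^{n₀(d)}` is `κ`-balanced, then every degree-`≤ d`
polynomial on every cube of dimension `≥ n₀(d)` is `κ`-balanced — with the same `κ` for all `d`.
(Cell statement, TARGET.md §17.8(e) (1).) -/
theorem pldams_of_critical_dimension {κ : ℝ} {n₀ : ℕ → ℕ}
    (h : ∀ d : ℕ, ∀ g : CubeFn (ZMod 2) (n₀ d), g ∈ lowDeg (ZMod 2) (n₀ d) d → ∀ r : ℕ,
      κ * ((univ.filter fun v : Fin (n₀ d) → Bool => g v ≠ 0).card : ℝ) ≤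
        ((univ.filter fun v : Fin (n₀ d) → Bool => g v ≠ 0 ∧ wt v % 3 = r % 3).card : ℝ)) :
    ∀ d n : ℕ, n₀ d ≤ n → ∀ g : CubeFn (ZMod 2) n, g ∈ lowDeg (ZMod 2) n d → ∀ r : ℕ,
      κ * ((univ.filter fun u : Fin n → Bool => g u ≠ 0).card : ℝ) ≤
        ((univ.filter fun u : Fin n → Bool => g u ≠ 0 ∧ wt u % 3 = r % 3).card : ℝ) :=
  fun d n hn => residueBalance_real_mono (h d) n hn

end Summit.QuantumAdvantage.AdviceFreeQNC0
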